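import Summits.BirchSwinnertonDyer.BirchSwinnertonDyer.Theorems.PrintCFramBottomClassIndexLawFiveLeSelmerCountCaseSLocal
import Summits.BirchSwinnertonDyer.BirchSwinnertonDyer.Theorems.PrintCFramBottomClassIndexLawFiveLeLevelDictionaryBetaPartner
import HarnessLib

/-!
# Route `PrintCFram`, crux C2 `BottomClassIndexLawFiveLe` (stmt-BirchSwinnertonDyer-20372), line
# `eisenstein-resource-bdp-line` (registry v19/v20): **CASE S IN LOCAL CURRENCY, ON THE ONE RATIONAL LINE** — CASE S_loc (a statement
# over ALL stable lines and ALL complex conjugations) reduces to ONE line `W[𝔭]`, its sign, and ONE local divisibility condition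
# (cell `bsd-print-cfram`, width seat `bsd-line-cfram-p1-w6` g4; helper `--supports` 20372; 0 defs, 0 facts, 0 sorry)

HONEST FRAMING. Nothing about BSD is proved unconditionally here and no stub is closed. Sequel of `…SelmerCountCaseSLocal` (CASE S_loc ⟹ w2 g9's
CASE S package) using w5 g3's UNIQUENESS of the stable line of order `p` on the CM-ramified class
(`LevelDictionaryBeta.toAddSubgroup_eq_of_card_eq_of_cmRamified`). Notation of `…SelmerDevissageLocalCriterion`: (LA)(Φ) / (LT)(Φ) at `v ∣ p`.

* §1 sign bookkeeping on a line of prime order: `smul_eq_neg_of_apply_eq_neg_one` / `smul_eq_self_of_apply_eq_one` (the character `θ` of the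
  line, `HerbrandLineRestriction.exists_character_of_card_prime`, evaluated at a complex conjugation: `θ c = −1` ⟹ `c = −1` on the line,
  `θ c = 1` ⟹ `c = +1`), `eq_zero_of_smul_eq_neg_of_smul_eq_self` (no non-zero vector is both, `p` odd).
* §2 **`caseS_local_of_odd_line`** — on a class member (`W` CM globally minimal, `p ≥ 5` CM-ramified, `v ∣ p`): if ONE stable line `Φ₀` of order `p`
  is ODD (every complex conjugation acts by `−1` on it) and satisfies (LT)(Φ₀), then CASE S_loc holds (for every stable line `Φ` of order `p`,
  `Φ = Φ₀` as a subgroup; its even branch is vacuous); **`caseS_local_of_even_line`** — dually, `Φ₀` EVEN with (LA)(Φ₀) ⟹ CASE S_loc.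
* §3 the packaged readings: **`bsdp_iff_shaAnUnit_of_odd_line_of_forall_imp`**, **`bsdp_iff_shaAnUnit_of_even_line_of_forall_exists`**,
  `sha_noPTorsion_of_odd_line_of_forall_imp`, `sha_noPTorsion_of_even_line_of_forall_exists` — «`‖B_{1,ψ⁻¹}‖ = p⁻¹` ∧ (W[𝔭] odd ∧ (LT)) resp.
  (W[𝔭] even ∧ (LA)) ⟹ Ш(W)[p] = 0 and `BSDp W p ↔ p ∤ #Ш_an(W)`» (mod MW Thm 2, Cassels–Tate, GZK, `r_an = 1`) — the per-member certificate shape of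
  the small-Selmer branch of B1: ONE line, ONE sign, ONE statement about `p`-division points of `W(ℚ_p)`.

THEOREMS ONLY; no definition, no named fact, no `sorry`. BSD is not proved by any of this; no summit statement is proved by this seat. References:
[SilvermanAEC2009] X.§4 (Rem. 4.7); [MazurWiles1984] Thm. 2; [Cassels1962ArithmeticIV]; seat notes w2g9 §3, w6g4.
-/

set_option autoImplicit false
-- `…BirchSwinnertonDyer.BirchSwinnertonDyer.Theorems…` is the problem's mandated namespace (D-0017).
set_option linter.dupNamespace false

noncomputable section

open scoped Classical

namespace Summit.BirchSwinnertonDyer.BirchSwinnertonDyer.Theorems.PrintCFram.SelmerCount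

open NumberField IsDedekindDomain Field WeierstrassCurve DirichletCharacter
open Literature.NumberTheory.NumberFields Literature.NumberTheory.EllipticCurves Literature.NumberTheory.GaloisRepresentations
  Literature.NumberTheory.EllipticCurves.GreenbergSelmer Literature.NumberTheory.EllipticCurves.Rank1Residual
  Literature.NumberTheory.EllipticCurves.KrizLi2019
open Summit.BirchSwinnertonDyer.Rank1Residual Summit.BirchSwinnertonDyer.Rank1Residual.X2.ResidualDevissageModules
open Summit.BirchSwinnertonDyer.BirchSwinnertonDyer.Theorems.PrintCFram.LevelDictionaryBeta

variable {p : ℕ} [hp : Fact p.Prime]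

/-! ## §1 Signs on a line of prime order -/

section Sign

variable {G : Type} [Group G] {A : Type} [AddCommGroup A] [DistribMulAction G A]

/-- On a line of order `p` with character `θ` (`g • x = (θ g).val • x`): `θ c = −1` ⟹ `c • x = −x`. [folklore] -/
theorem smul_eq_neg_of_apply_eq_neg_one (hcard : Nat.card A = p) (θ : G →* (ZMod p)ˣ)
    (hθ : ∀ (g : G) (x : A), g • x = (((θ g : ZMod p).val : ℕ) : ℤ) • x) {c : G} (hc : θ c = -1) (x : A) :
    c • x = -x := by
  have hpr := hp.out
  rw [hθ c x, hc, Units.val_neg, Units.val_one, ZMod.neg_val', ZMod.val_one,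
    Nat.mod_eq_of_lt (Nat.sub_lt hpr.pos Nat.one_pos), Nat.cast_sub hpr.one_lt.le, Nat.cast_one, sub_smul, one_smul,
    natCast_zsmul, HerbrandLineRestriction.prime_nsmul_eq_zero_of_card_prime hcard x, zero_sub]

/-- On a line with character `θ`: `θ c = 1` ⟹ `c • x = x`. [folklore] -/
theorem smul_eq_self_of_apply_eq_one (θ : G →* (ZMod p)ˣ)
    (hθ : ∀ (g : G) (x : A), g • x = (((θ g : ZMod p).val : ℕ) : ℤ) • x) {c : G} (hc : θ c = 1) (x : A) :
    c • x = x := by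
  haveI : Fact (1 < p) := ⟨hp.out.one_lt⟩
  rw [hθ c x, hc, Units.val_one, ZMod.val_one, Nat.cast_one, one_smul]

omit [DistribMulAction G A] in
/-- In a group of odd prime order no non-zero element equals its negative. [folklore] -/
theorem eq_zero_of_eq_neg_of_card_prime (hcard : Nat.card A = p) (hp2 : p ≠ 2) {x : A} (hx : x = -x) : x = 0 := by
  obtain ⟨k, hk⟩ := hp.out.odd_of_ne_two hp2
  have h2 : 2 • x = 0 := by rw [two_nsmul]; exact eq_neg_iff_add_eq_zero.mp hx
  have hpx : p • x = 0 := HerbrandLineRestriction.prime_nsmul_eq_zero_of_card_prime hcard x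
  rw [hk, add_nsmul, one_nsmul, mul_nsmul, h2, smul_zero, zero_add] at hpx
  exact hpx

end Sign

/-! ## §2 CASE S_loc from one line -/

section OneLine

variable (W : WeierstrassCurve ℚ) [W.IsElliptic] [W.IsGloballyMinimal]

omit [W.IsGloballyMinimal] in
/-- **CASE S_loc from ONE ODD line with (LT).** `W` CM, `p ≥ 5` CM-ramified, `v` a finite place; `Φ₀ ≤ W[p]` a stable line of order `p` on which every
complex conjugation acts by `−1`, satisfying (LT)(Φ₀) at `v`. Then CASE S_loc (the hypothesis `hSloc` of `natCard_selmerGroup_le_sq_of_caseS_local`):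
every stable line `Φ` of order `p` equals `Φ₀` as a subgroup (w5 g3's uniqueness `toAddSubgroup_eq_of_card_eq_of_cmRamified`), so (LT) transfers and
the «`c = +1` on `Φ`» branch is vacuous (`p` odd). [cite: SilvermanAEC2009, X.§4 (Rem. 4.7)] -/
theorem caseS_local_of_odd_line (hCM : W.HasCM) (h5 : 5 ≤ p) (hram : CMRamified W p) (v : HeightOneSpectrum (𝓞 ℚ))
    (Φ₀ : StableSubgroup (absoluteGaloisGroup ℚ) (geomTorsion W (p : ℤ))) (hcard₀ : Nat.card Φ₀.Sub = p)
    (hodd : ∀ c : absoluteGaloisGroup ℚ, IsComplexConjugation (Rat.castHom ℝ) c → ∀ x : Φ₀.Sub, c • x = -x)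
    (hLT₀ : ∀ P : (W.baseChange (v.adicCompletion ℚ)).toAffine.Point,
      (∃ R : localPoints W (v.adicCompletion ℚ),
        (p : ℤ) • R = Affine.Point.map (W' := W)
          (IsScalarTower.toAlgHom ℚ (v.adicCompletion ℚ) (AlgebraicClosure (v.adicCompletion ℚ))) P ∧
        ∀ σ : absoluteGaloisGroup (v.adicCompletion ℚ), ∃ t ∈ Φ₀.toAddSubgroup,
          σ • R - R = pointsMap W (v.adicCompletion ℚ) (t : geomPoints W)) →
      ∃ S : (W.baseChange (v.adicCompletion ℚ)).toAffine.Point, p • S = P) :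
    ∀ (Φ : StableSubgroup (absoluteGaloisGroup ℚ) (geomTorsion W (p : ℤ))), Nat.card Φ.Sub = p →
      ∀ c : absoluteGaloisGroup ℚ, IsComplexConjugation (Rat.castHom ℝ) c →
        ((∀ x : Φ.Sub, c • x = -x) →
          ∀ P : (W.baseChange (v.adicCompletion ℚ)).toAffine.Point,
            (∃ R : localPoints W (v.adicCompletion ℚ),
              (p : ℤ) • R = Affine.Point.map (W' := W)
                (IsScalarTower.toAlgHom ℚ (v.adicCompletion ℚ) (AlgebraicClosure (v.adicCompletion ℚ))) P ∧
              ∀ σ : absoluteGaloisGroup (v.adicCompletion ℚ), ∃ t ∈ Φ.toAddSubgroup,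
                σ • R - R = pointsMap W (v.adicCompletion ℚ) (t : geomPoints W)) →
            ∃ S : (W.baseChange (v.adicCompletion ℚ)).toAffine.Point, p • S = P) ∧
        ((∀ x : Φ.Sub, c • x = x) →
          ∀ P : (W.baseChange (v.adicCompletion ℚ)).toAffine.Point,
            ∃ R : localPoints W (v.adicCompletion ℚ),
              (p : ℤ) • R = Affine.Point.map (W' := W)
                (IsScalarTower.toAlgHom ℚ (v.adicCompletion ℚ) (AlgebraicClosure (v.adicCompletion ℚ))) P ∧
              ∀ σ : absoluteGaloisGroup (v.adicCompletion ℚ), ∃ t ∈ Φ.toAddSubgroup,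
                σ • R - R = pointsMap W (v.adicCompletion ℚ) (t : geomPoints W)) := by
  have hp2 : p ≠ 2 := by omega
  intro Φ hcard c hc
  have heq : Φ.toAddSubgroup = Φ₀.toAddSubgroup := toAddSubgroup_eq_of_card_eq_of_cmRamified W hCM h5 hram Φ Φ₀ hcard hcard₀
  refine ⟨fun _ P hP ↦ hLT₀ P ?_, fun heven ↦ ?_⟩
  · obtain ⟨R, hR, hRΦ⟩ := hP
    exact ⟨R, hR, fun σ ↦ by obtain ⟨t, ht, h⟩ := hRΦ σ; exact ⟨t, heq ▸ ht, h⟩⟩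
  · -- the even branch is vacuous: a non-zero vector of `Φ = Φ₀` would be both fixed and negated by `c`
    exfalso
    haveI : Finite Φ.Sub := Nat.finite_of_card_ne_zero (by rw [hcard]; exact hp.out.ne_zero)
    haveI : Nontrivial Φ.Sub := Finite.one_lt_card_iff_nontrivial.mp (by rw [hcard]; exact hp.out.one_lt)
    obtain ⟨x, hx⟩ := exists_ne (0 : Φ.Sub)
    have hxmem : Φ.incl x ∈ Φ₀.toAddSubgroup := heq ▸ x.2
    set x₀ : Φ₀.Sub := ⟨Φ.incl x, hxmem⟩ with hx₀
    have h1 : c • Φ.incl x = -Φ.incl x := by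
      have h := congrArg Φ₀.incl (hodd c hc x₀)
      rw [Φ₀.incl_smul, map_neg] at h
      exact h
    have h2 : c • Φ.incl x = Φ.incl x := by rw [← Φ.incl_smul, heven x]
    have h3 : x = -x := Φ.incl_injective (by rw [map_neg, ← h1, h2])
    exact hx (eq_zero_of_eq_neg_of_card_prime hcard hp2 h3)

omit [W.IsGloballyMinimal] in
/-- **CASE S_loc from ONE EVEN line with (LA).** Dually: `Φ₀` a stable line of order `p` fixed by every complex conjugation and satisfying (LA)(Φ₀) at
`v` ⟹ CASE S_loc. [cite: SilvermanAEC2009, X.§4 (Rem. 4.7)] -/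
theorem caseS_local_of_even_line (hCM : W.HasCM) (h5 : 5 ≤ p) (hram : CMRamified W p) (v : HeightOneSpectrum (𝓞 ℚ))
    (Φ₀ : StableSubgroup (absoluteGaloisGroup ℚ) (geomTorsion W (p : ℤ))) (hcard₀ : Nat.card Φ₀.Sub = p)
    (heven : ∀ c : absoluteGaloisGroup ℚ, IsComplexConjugation (Rat.castHom ℝ) c → ∀ x : Φ₀.Sub, c • x = x)
    (hLA₀ : ∀ P : (W.baseChange (v.adicCompletion ℚ)).toAffine.Point,
      ∃ R : localPoints W (v.adicCompletion ℚ),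
        (p : ℤ) • R = Affine.Point.map (W' := W)
          (IsScalarTower.toAlgHom ℚ (v.adicCompletion ℚ) (AlgebraicClosure (v.adicCompletion ℚ))) P ∧
        ∀ σ : absoluteGaloisGroup (v.adicCompletion ℚ), ∃ t ∈ Φ₀.toAddSubgroup,
          σ • R - R = pointsMap W (v.adicCompletion ℚ) (t : geomPoints W)) :
    ∀ (Φ : StableSubgroup (absoluteGaloisGroup ℚ) (geomTorsion W (p : ℤ))), Nat.card Φ.Sub = p →
      ∀ c : absoluteGaloisGroup ℚ, IsComplexConjugation (Rat.castHom ℝ) c →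
        ((∀ x : Φ.Sub, c • x = -x) →
          ∀ P : (W.baseChange (v.adicCompletion ℚ)).toAffine.Point,
            (∃ R : localPoints W (v.adicCompletion ℚ),
              (p : ℤ) • R = Affine.Point.map (W' := W)
                (IsScalarTower.toAlgHom ℚ (v.adicCompletion ℚ) (AlgebraicClosure (v.adicCompletion ℚ))) P ∧
              ∀ σ : absoluteGaloisGroup (v.adicCompletion ℚ), ∃ t ∈ Φ.toAddSubgroup,
                σ • R - R = pointsMap W (v.adicCompletion ℚ) (t : geomPoints W)) →
            ∃ S : (W.baseChange (v.adicCompletion ℚ)).toAffine.Point, p • S = P) ∧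
        ((∀ x : Φ.Sub, c • x = x) →
          ∀ P : (W.baseChange (v.adicCompletion ℚ)).toAffine.Point,
            ∃ R : localPoints W (v.adicCompletion ℚ),
              (p : ℤ) • R = Affine.Point.map (W' := W)
                (IsScalarTower.toAlgHom ℚ (v.adicCompletion ℚ) (AlgebraicClosure (v.adicCompletion ℚ))) P ∧
              ∀ σ : absoluteGaloisGroup (v.adicCompletion ℚ), ∃ t ∈ Φ.toAddSubgroup,
                σ • R - R = pointsMap W (v.adicCompletion ℚ) (t : geomPoints W)) := by
  have hp2 : p ≠ 2 := by omega
  intro Φ hcard c hc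
  have heq : Φ.toAddSubgroup = Φ₀.toAddSubgroup := toAddSubgroup_eq_of_card_eq_of_cmRamified W hCM h5 hram Φ Φ₀ hcard hcard₀
  refine ⟨fun hodd ↦ ?_, fun _ P ↦ ?_⟩
  · exfalso
    haveI : Finite Φ.Sub := Nat.finite_of_card_ne_zero (by rw [hcard]; exact hp.out.ne_zero)
    haveI : Nontrivial Φ.Sub := Finite.one_lt_card_iff_nontrivial.mp (by rw [hcard]; exact hp.out.one_lt)
    obtain ⟨x, hx⟩ := exists_ne (0 : Φ.Sub)
    have hxmem : Φ.incl x ∈ Φ₀.toAddSubgroup := heq ▸ x.2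
    set x₀ : Φ₀.Sub := ⟨Φ.incl x, hxmem⟩ with hx₀
    have h1 : c • Φ.incl x = Φ.incl x := by
      have h := congrArg Φ₀.incl (heven c hc x₀)
      rw [Φ₀.incl_smul] at h
      exact h
    have h2 : c • Φ.incl x = -Φ.incl x := by rw [← Φ.incl_smul, hodd x, map_neg]
    have h3 : x = -x := Φ.incl_injective (by rw [map_neg, ← h2, h1])
    exact hx (eq_zero_of_eq_neg_of_card_prime hcard hp2 h3)
  · obtain ⟨R, hR, hRΦ⟩ := hLA₀ P
    exact ⟨R, hR, fun σ ↦ by obtain ⟨t, ht, h⟩ := hRΦ σ; exact ⟨t, heq ▸ ht, h⟩⟩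

end OneLine

/-! ## §3 The packaged readings: one line, one sign, one local statement -/

section Packaged

variable (W : WeierstrassCurve ℚ) [W.IsElliptic] [W.IsGloballyMinimal]

/-- **ODD line ∧ (LT) ∧ `‖B_{1,ψ⁻¹}‖ = p⁻¹` ⟹ `Ш(W)[p] = 0`** (+ hMW, hCT, hGZK, `r_an = 1`): `sha_noPTorsion_of_caseS_local` ∘ `caseS_local_of_odd_line`.
[cite: MazurWiles1984, Thm. 2 (p. 214)] [cite: Cassels1962ArithmeticIV] -/
theorem sha_noPTorsion_of_odd_line_of_forall_imp (hMW : MazurWiles1984.thm2_card_oddChiClassGroup_eq_bernoulli)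
    (hCT : exists_casselsTate_pairing (K := ℚ)) (hGZK : rank_eq_analyticRank_of_analyticRank_le_one)
    (hCM : W.HasCM) (hram : CMRamified W p) (h5 : 5 ≤ p) (hr : W.analyticRank = 1)
    {f : ℕ} [NeZero f] (ψ : DirichletCharacter ℚ_[p] f) (ω : DirichletCharacter ℚ_[p] p)
    (hψ : ψ.Odd) (hω : IsTeichmullerCharacter ω)
    (hss : ∀ ℓ : ℕ, ℓ.Prime → ¬ (ℓ ∣ p * W.conductorNorm ℤ) →
      ‖((W.LFunction ℓ : ℤ) : ℚ_[p]) - (ψ (ℓ : ZMod f) + ψ⁻¹ (ℓ : ZMod f) * ω (ℓ : ZMod p))‖ < 1)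
    (hB : ‖bernoulliOnePrim ψ⁻¹‖ = (p : ℝ)⁻¹)
    {v : HeightOneSpectrum (𝓞 ℚ)} (hpv : ((p : ℕ) : 𝓞 ℚ) ∈ v.asIdeal)
    (Φ₀ : StableSubgroup (absoluteGaloisGroup ℚ) (geomTorsion W (p : ℤ))) (hcard₀ : Nat.card Φ₀.Sub = p)
    (hodd : ∀ c : absoluteGaloisGroup ℚ, IsComplexConjugation (Rat.castHom ℝ) c → ∀ x : Φ₀.Sub, c • x = -x)
    (hLT₀ : ∀ P : (W.baseChange (v.adicCompletion ℚ)).toAffine.Point,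
      (∃ R : localPoints W (v.adicCompletion ℚ),
        (p : ℤ) • R = Affine.Point.map (W' := W)
          (IsScalarTower.toAlgHom ℚ (v.adicCompletion ℚ) (AlgebraicClosure (v.adicCompletion ℚ))) P ∧
        ∀ σ : absoluteGaloisGroup (v.adicCompletion ℚ), ∃ t ∈ Φ₀.toAddSubgroup,
          σ • R - R = pointsMap W (v.adicCompletion ℚ) (t : geomPoints W)) →
      ∃ S : (W.baseChange (v.adicCompletion ℚ)).toAffine.Point, p • S = P) :
    ∀ x : W.sha, (p : ℤ) • x = 0 → x = 0 :=
  sha_noPTorsion_of_caseS_local W hMW hCT hGZK hCM hram h5 hr ψ ω hψ hω hss hB hpv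
    (caseS_local_of_odd_line W hCM h5 hram v Φ₀ hcard₀ hodd hLT₀)

/-- **ODD line ∧ (LT) ∧ `‖B_{1,ψ⁻¹}‖ = p⁻¹` ⟹ (`BSDp W p ↔ p ∤ #Ш_an(W)`)** (+ hMW, hCT, hGZK, `r_an = 1`).
[cite: MazurWiles1984, Thm. 2 (p. 214)] [cite: Cassels1962ArithmeticIV] [cite: Miller2011LMS, Def. 1.1] -/
theorem bsdp_iff_shaAnUnit_of_odd_line_of_forall_imp (hMW : MazurWiles1984.thm2_card_oddChiClassGroup_eq_bernoulli)
    (hCT : exists_casselsTate_pairing (K := ℚ)) (hGZK : rank_eq_analyticRank_of_analyticRank_le_one)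
    (hCM : W.HasCM) (hram : CMRamified W p) (h5 : 5 ≤ p) (hr : W.analyticRank = 1)
    {f : ℕ} [NeZero f] (ψ : DirichletCharacter ℚ_[p] f) (ω : DirichletCharacter ℚ_[p] p)
    (hψ : ψ.Odd) (hω : IsTeichmullerCharacter ω)
    (hss : ∀ ℓ : ℕ, ℓ.Prime → ¬ (ℓ ∣ p * W.conductorNorm ℤ) →
      ‖((W.LFunction ℓ : ℤ) : ℚ_[p]) - (ψ (ℓ : ZMod f) + ψ⁻¹ (ℓ : ZMod f) * ω (ℓ : ZMod p))‖ < 1)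
    (hB : ‖bernoulliOnePrim ψ⁻¹‖ = (p : ℝ)⁻¹)
    {v : HeightOneSpectrum (𝓞 ℚ)} (hpv : ((p : ℕ) : 𝓞 ℚ) ∈ v.asIdeal)
    (Φ₀ : StableSubgroup (absoluteGaloisGroup ℚ) (geomTorsion W (p : ℤ))) (hcard₀ : Nat.card Φ₀.Sub = p)
    (hodd : ∀ c : absoluteGaloisGroup ℚ, IsComplexConjugation (Rat.castHom ℝ) c → ∀ x : Φ₀.Sub, c • x = -x)
    (hLT₀ : ∀ P : (W.baseChange (v.adicCompletion ℚ)).toAffine.Point,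
      (∃ R : localPoints W (v.adicCompletion ℚ),
        (p : ℤ) • R = Affine.Point.map (W' := W)
          (IsScalarTower.toAlgHom ℚ (v.adicCompletion ℚ) (AlgebraicClosure (v.adicCompletion ℚ))) P ∧
        ∀ σ : absoluteGaloisGroup (v.adicCompletion ℚ), ∃ t ∈ Φ₀.toAddSubgroup,
          σ • R - R = pointsMap W (v.adicCompletion ℚ) (t : geomPoints W)) →
      ∃ S : (W.baseChange (v.adicCompletion ℚ)).toAffine.Point, p • S = P) :
    BSDp W p ↔ ∃ q : ℚ, shaAn W = (q : ℂ) ∧ padicValRat p q = 0 :=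
  bsdp_iff_shaAnUnit_of_caseS_local W hMW hCT hGZK hCM hram h5 hr ψ ω hψ hω hss hB hpv
    (caseS_local_of_odd_line W hCM h5 hram v Φ₀ hcard₀ hodd hLT₀)

/-- **EVEN line ∧ (LA) ∧ `‖B_{1,ψ⁻¹}‖ = p⁻¹` ⟹ `Ш(W)[p] = 0`** (+ hMW, hCT, hGZK, `r_an = 1`).
[cite: MazurWiles1984, Thm. 2 (p. 214)] [cite: Cassels1962ArithmeticIV] -/
theorem sha_noPTorsion_of_even_line_of_forall_exists (hMW : MazurWiles1984.thm2_card_oddChiClassGroup_eq_bernoulli)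
    (hCT : exists_casselsTate_pairing (K := ℚ)) (hGZK : rank_eq_analyticRank_of_analyticRank_le_one)
    (hCM : W.HasCM) (hram : CMRamified W p) (h5 : 5 ≤ p) (hr : W.analyticRank = 1)
    {f : ℕ} [NeZero f] (ψ : DirichletCharacter ℚ_[p] f) (ω : DirichletCharacter ℚ_[p] p)
    (hψ : ψ.Odd) (hω : IsTeichmullerCharacter ω)
    (hss : ∀ ℓ : ℕ, ℓ.Prime → ¬ (ℓ ∣ p * W.conductorNorm ℤ) →
      ‖((W.LFunction ℓ : ℤ) : ℚ_[p]) - (ψ (ℓ : ZMod f) + ψ⁻¹ (ℓ : ZMod f) * ω (ℓ : ZMod p))‖ < 1)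
    (hB : ‖bernoulliOnePrim ψ⁻¹‖ = (p : ℝ)⁻¹)
    {v : HeightOneSpectrum (𝓞 ℚ)} (hpv : ((p : ℕ) : 𝓞 ℚ) ∈ v.asIdeal)
    (Φ₀ : StableSubgroup (absoluteGaloisGroup ℚ) (geomTorsion W (p : ℤ))) (hcard₀ : Nat.card Φ₀.Sub = p)
    (heven : ∀ c : absoluteGaloisGroup ℚ, IsComplexConjugation (Rat.castHom ℝ) c → ∀ x : Φ₀.Sub, c • x = x)
    (hLA₀ : ∀ P : (W.baseChange (v.adicCompletion ℚ)).toAffine.Point,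
      ∃ R : localPoints W (v.adicCompletion ℚ),
        (p : ℤ) • R = Affine.Point.map (W' := W)
          (IsScalarTower.toAlgHom ℚ (v.adicCompletion ℚ) (AlgebraicClosure (v.adicCompletion ℚ))) P ∧
        ∀ σ : absoluteGaloisGroup (v.adicCompletion ℚ), ∃ t ∈ Φ₀.toAddSubgroup,
          σ • R - R = pointsMap W (v.adicCompletion ℚ) (t : geomPoints W)) :
    ∀ x : W.sha, (p : ℤ) • x = 0 → x = 0 :=
  sha_noPTorsion_of_caseS_local W hMW hCT hGZK hCM hram h5 hr ψ ω hψ hω hss hB hpv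
    (caseS_local_of_even_line W hCM h5 hram v Φ₀ hcard₀ heven hLA₀)

/-- **EVEN line ∧ (LA) ∧ `‖B_{1,ψ⁻¹}‖ = p⁻¹` ⟹ (`BSDp W p ↔ p ∤ #Ш_an(W)`)** (+ hMW, hCT, hGZK, `r_an = 1`).
[cite: MazurWiles1984, Thm. 2 (p. 214)] [cite: Cassels1962ArithmeticIV] [cite: Miller2011LMS, Def. 1.1] -/
theorem bsdp_iff_shaAnUnit_of_even_line_of_forall_exists (hMW : MazurWiles1984.thm2_card_oddChiClassGroup_eq_bernoulli)
    (hCT : exists_casselsTate_pairing (K := ℚ)) (hGZK : rank_eq_analyticRank_of_analyticRank_le_one)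
    (hCM : W.HasCM) (hram : CMRamified W p) (h5 : 5 ≤ p) (hr : W.analyticRank = 1)
    {f : ℕ} [NeZero f] (ψ : DirichletCharacter ℚ_[p] f) (ω : DirichletCharacter ℚ_[p] p)
    (hψ : ψ.Odd) (hω : IsTeichmullerCharacter ω)
    (hss : ∀ ℓ : ℕ, ℓ.Prime → ¬ (ℓ ∣ p * W.conductorNorm ℤ) →
      ‖((W.LFunction ℓ : ℤ) : ℚ_[p]) - (ψ (ℓ : ZMod f) + ψ⁻¹ (ℓ : ZMod f) * ω (ℓ : ZMod p))‖ < 1)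
    (hB : ‖bernoulliOnePrim ψ⁻¹‖ = (p : ℝ)⁻¹)
    {v : HeightOneSpectrum (𝓞 ℚ)} (hpv : ((p : ℕ) : 𝓞 ℚ) ∈ v.asIdeal)
    (Φ₀ : StableSubgroup (absoluteGaloisGroup ℚ) (geomTorsion W (p : ℤ))) (hcard₀ : Nat.card Φ₀.Sub = p)
    (heven : ∀ c : absoluteGaloisGroup ℚ, IsComplexConjugation (Rat.castHom ℝ) c → ∀ x : Φ₀.Sub, c • x = x)
    (hLA₀ : ∀ P : (W.baseChange (v.adicCompletion ℚ)).toAffine.Point,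
      ∃ R : localPoints W (v.adicCompletion ℚ),
        (p : ℤ) • R = Affine.Point.map (W' := W)
          (IsScalarTower.toAlgHom ℚ (v.adicCompletion ℚ) (AlgebraicClosure (v.adicCompletion ℚ))) P ∧
        ∀ σ : absoluteGaloisGroup (v.adicCompletion ℚ), ∃ t ∈ Φ₀.toAddSubgroup,
          σ • R - R = pointsMap W (v.adicCompletion ℚ) (t : geomPoints W)) :
    BSDp W p ↔ ∃ q : ℚ, shaAn W = (q : ℂ) ∧ padicValRat p q = 0 :=
  bsdp_iff_shaAnUnit_of_caseS_local W hMW hCT hGZK hCM hram h5 hr ψ ω hψ hω hss hB hpv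
    (caseS_local_of_even_line W hCM h5 hram v Φ₀ hcard₀ heven hLA₀)

end Packaged

end Summit.BirchSwinnertonDyer.BirchSwinnertonDyer.Theorems.PrintCFram.SelmerCount

end
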